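import Summits.AtomisticToContinuum.Crystallization.Theorems.ChartedZeroExcessLayeredLatticeLiouvilleYV

/-!
# Part YW «RigidChain» (lens-2 g72): the node junction (Gh♯) ⟸ (Gl♯) ∧ (Gp♯) and the rigid-reference chain down to (QE) — all PROVED

Docket `stmt-AtomisticToContinuum-26636` (N = `…Theses.ChartedPlanarOrder.ChartedZeroExcessLayered`), cell decomp-a2c RESIDUAL MODE, lens-2, generation 72,
layer 2 of part YV «RigidReference» (imported; pieces (XR♯) / (Gl♯) / (Gp♯) / (Gh♯), class currencies, engines).  §YW-0 proves the NODE: (Gh♯) from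
(Gl♯) ∧ (Gp♯) ∧ Neumann-1 arithmetic, the patch's fatness being DERIVED from the registration (`isFatPatch_of_collarRegistered`), with the comparison
teeth (XR♯) ⇒ (XR) and (Gh) ⇒ (Gh♯); §YW-1/2 carry the restriction «reference rigid and collar-registered» down the existing load-path chain of parts
YO / YQ v2 / YS, whose junctions quantify over ALL tube references and are therefore re-proved verbatim with the two extra binders threaded through.
The universally quantified tree pieces (X1) `TubeConvexityP`, (Gs) `TangentDriftP`, (Res) `ReferenceLoadP` (PROVED cut (Rn) ∧ (Rt), part YR) are consumed
UNCHANGED; only the existence piece changes, to (XR♯).  The slot theorem meets the literal leaf `CoolMoatSlavedFillingP ϑm ϑf ϑp 8 4 12 16 16 (1/2) 1 2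
(1/16) (1/50)` of `VariationalMildDocket` (part YI, column `_16XH28BVT`, `∃ ϑm`: every new dial is free).  0 sorry; standard axioms.

## The chain (this part; every junction PROVED)
  (Gh♯) ⟸ (Gl♯) `PlacedPerfectResponseP q (ρ − ε) (ρ + dm) Rl Ru Rg Rφ G …` ∧ (Gp♯) `CollarPinDriftP … ε Rl Ru κ …` ∧ `Gκ ≤ qN ρᵒ`, `qN < 1`,
          `ρ − ε < r + rsh` (`rigidHarmonicResponseP_of_placed`, matrix `H = G + (Gκ)w/(1 − qN)`);
  (G∞♯) ⟸ (Gh♯) ∧ (Gs) `TangentDriftP … κ′ …` ∧ Neumann-2 (`rigidTubeResponseP_of_tangent`, as part YS);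
  (X2ᴸ♯) ⟸ (G∞♯) ∧ (Res) `ReferenceLoadP … εg εI εb …` ∧ `C·ε_load ≤ ρ₁` (`rigidLoadedTubeAprioriP_of_response`, as part YQ v2);
  (QE) ⟸ (XR♯) `RigidReferenceP … ε Rl Ru …` ∧ (X1) ∧ (X2ᴸ♯) ∧ `ρ₁ + lam·gap ≤ ρᵒ` (`coolMoatSlavedFillingP_of_rigidLoadPath`, as part YO); the slot; and the
  whole line in one theorem `coolMoatSlavedFillingP_of_rigidTangentLine`.
Leaves of the 26636 existence line under the rigid reference: (XR♯) [SPECIAL∃ · KINEMATIC «RigidFit-T»], (X1) [CERT «NearBorn-T»], (Gl♯) [SPECIAL · CERT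
«GreenRow-T(perfect, band)»], (Gp♯) [GENERIC · FORWARD «PinDrift-R»], (Gs) [GENERIC · FORWARD «Drift-T»], (Rn) ∧ (Rt) [KINEMATIC «RefLoad-T»]: every
configuration-dependent leaf is FORWARD or KINEMATIC; the two inversions ((X1)'s convexity modulus, (Gl♯)'s Green rows) are properties of ONE perfect patch.

## Sources
parts YO (glue, slot), YQ v2 (`loadedTubeAprioriP_of_response`), YS (`tubeResponseP_of_tangent`, `bondTube_bootstrap`), YR ((Res) cut), YV, held YT of g71
(junction template); CRITIC-LEDGER rows 1237, 1250, 1272, 1274, 1283, 1295.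
-/

noncomputable section
open scoped BigOperators Classical InnerProductSpace RealInnerProductSpace
open MeasureTheory Set Metric Filter Topology
open Summit.AtomisticToContinuum.Crystallization.Theorems.ChartedPlanarOrderRigidityDoor (E3 eStar atomsIn IsEStarGSC siteEnergy VisibleGap PertRegime)
open Summit.AtomisticToContinuum.Crystallization.Theorems.ChartedPlanarOrderDensityDichotomy (μS IsSep nK nK_nonneg)
open Summit.AtomisticToContinuum.Crystallization.Theorems.ChartedPlanarOrderCleanScaleP (IsCleanP IsDoorSetP)
open Summit.AtomisticToContinuum.Crystallization.Theorems.ChartedPlanarOrderMesoCut (LayeredHom EnvClose)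
open Summit.AtomisticToContinuum.Crystallization.Theorems.ChartedPlanarOrderDoorLayered (atomsIn_subset sq_le_finsum_mem PeriodicBulkGapDoor)
open Summit.AtomisticToContinuum.Crystallization.Theorems.ChartedPlanarOrderDoorLayeredOsc (IsTwoShellAffineGood)
open Literature.MathematicalPhysics.StatisticalMechanics (card_le_of_separated_of_dist_le lennardJones interactionEnergy)

namespace Summit.AtomisticToContinuum.Crystallization.Theorems.ChartedZeroExcessLayeredLatticeLiouville

/-! ### YW-0  THE NODE JUNCTION (PROVED): (Gh♯) ⟸ (Gl♯) ∧ (Gp♯) ∧ Neumann arithmetic, fatness DERIVED; teeth (XR♯) ⇒ (XR), (Gh) ⇒ (Gh♯); dials -/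

section NodeJunction

variable {n : ℕ}

/-- ★ **FATNESS IS DERIVED (PROVED)**: a tube reference that is a rigid collar-registered placed patch is `(q, ρ − ε, ρ + dm)`-fat with anchor set the
binders' `K` — inner radius from (M2) (an exterior crystal atom within `ρ − ε` of `K` would have an actual partner in `S ∖ core` within `ρ` of `K`),
outer radius from the matching clause of `IsTubeReference` at `y₀` itself (`self_mem_bondTube`).  Answers row 1295 (Gl-∀) with no new clause in (XR♯).
[this file, g72] -/
theorem isFatPatch_of_collarRegistered {S K X' H : Set E3} {x₀ : E3} {q ρ ℓ ε dm ϑ₀ ϑ Rl Rg Ru sb dI dB : ℝ} {xf y₀ : Fin n → E3}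
    (hsb : 0 ≤ sb) (hdI : 0 ≤ dI) (hdB : 0 ≤ dB) (hρℓ : ρ - ε < ℓ) (hKq : ∀ k ∈ K, dist k x₀ ≤ q) (hrange : Set.range xf = coreOf S K ρ)
    (hy₀ : IsTubeReference ϑ₀ ϑ dm Rg sb dI dB (S \ coreOf S K ρ) H xf y₀)
    (hreg : IsCollarRegistered ε Rl Rg Ru {z | ∃ k ∈ K, dist z k < ℓ} (S \ coreOf S K ρ) X' y₀) : IsFatPatch q (ρ - ε) (ρ + dm) X' y₀ := by
  obtain ⟨-, -, hnear, -⟩ := hy₀.2 y₀ (self_mem_bondTube hsb hdI hdB)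
  refine ⟨x₀, K, hKq, fun p' hp' k hk => ?_, fun i => ?_⟩
  · refine lt_of_not_ge fun hle => ?_
    obtain ⟨p, hp, hpp'⟩ := hreg.2.2.2 p' hp' ⟨k, hk, by linarith⟩
    exact hp.2 ⟨hp.1, k, hk, by linarith [dist_triangle p p' k]⟩
  · have hx : xf i ∈ coreOf S K ρ := by rw [← hrange]; exact Set.mem_range_self i
    obtain ⟨-, k, hk, hdk⟩ := hx
    exact ⟨k, hk, by linarith [dist_triangle (y₀ i) (xf i) k, dist_comm (xf i) (y₀ i), hnear i]⟩

/-- ★★★ **THE JUNCTION (PROVED): (Gl♯)(G) ∧ (Gp♯)(ε; κ) ∧ `0 ≤ qN < 1` ∧ `(Gκ)_k ≤ qN·ρᵒ_k` ∧ gauge weights `G_{k,c} ≤ w_c·ρᵒ_k` ⇒ (Gh♯)(G′) with the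
NEUMANN MATRIX `G′_{k,c} = G_{k,c} + (Gκ)_k·w_c/(1 − qN)`** (`ρᵒ = (sb, dI, dB) > 0`, `G_{s,·}, κ ≥ 0`).  For a rigid collar-registered reference `y₀ = Y`:
(Gl♯) pins `A` and is evaluated at the class `I := X-class(Rg)` (admissible by the sandwich of `IsCollarRegistered`), where class currencies ARE the
X-currencies (`rfl`); at gauge `l`, `A u = H u + (−1)·(H u − A u)` has levels `M + lκ` ((Gp♯), `.smul`, `.add`), so `y₀ + u ∈ T(GM + l·Gκ)`;
`bondTube_linear_bootstrap` from the finite start gauge of `u`.  No registration lemma is invoked: (Gr) ≡ id. [this file, g72] -/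
theorem rigidHarmonicResponseP_of_placed
    {ϑc ϑ ϑp r q rsh ρ rm dm ϑ₀ Rg sb dI dB Rφ ε Rl Ru GsG GsI GsB GIG GII GIB GBG GBI GBB κg κI κb qN wG wI wB aHi Λ θ s : ℝ}
    (hsb : 0 < sb) (hdI : 0 < dI) (hdB : 0 < dB) (hq0 : 0 ≤ qN) (hq1 : qN < 1) (hρB : ρ - ε < r + rsh)
    (h_sG : 0 ≤ GsG) (h_sI : 0 ≤ GsI) (h_sB : 0 ≤ GsB) (hκg : 0 ≤ κg) (hκI : 0 ≤ κI) (hκb : 0 ≤ κb)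
    (hwsG : GsG ≤ wG * sb) (hwIG : GIG ≤ wG * dI) (hwBG : GBG ≤ wG * dB) (hwsI : GsI ≤ wI * sb) (hwII : GII ≤ wI * dI) (hwBI : GBI ≤ wI * dB)
    (hwsB : GsB ≤ wB * sb) (hwIB : GIB ≤ wB * dI) (hwBB : GBB ≤ wB * dB)
    (hcs : GsG * κg + GsI * κI + GsB * κb ≤ qN * sb) (hcI : GIG * κg + GII * κI + GIB * κb ≤ qN * dI)
    (hcB : GBG * κg + GBI * κI + GBB * κb ≤ qN * dB)
    (hl : PlacedPerfectResponseP q (ρ - ε) (ρ + dm) Rl Ru Rg Rφ GsG GsI GsB GIG GII GIB GBG GBI GBB aHi Λ θ s)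
    (hp : CollarPinDriftP ϑc ϑ ϑp r q rsh ρ rm dm ϑ₀ Rg sb dI dB Rφ ε Rl Ru κg κI κb aHi Λ θ s) :
    RigidHarmonicResponseP ϑc ϑ ϑp r q rsh ρ rm dm ϑ₀ Rg sb dI dB Rφ ε Rl Ru
      (GsG + (GsG * κg + GsI * κI + GsB * κb) / (1 - qN) * wG) (GsI + (GsG * κg + GsI * κI + GsB * κb) / (1 - qN) * wI)
      (GsB + (GsG * κg + GsI * κI + GsB * κb) / (1 - qN) * wB)
      (GIG + (GIG * κg + GII * κI + GIB * κb) / (1 - qN) * wG) (GII + (GIG * κg + GII * κI + GIB * κb) / (1 - qN) * wI)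
      (GIB + (GIG * κg + GII * κI + GIB * κb) / (1 - qN) * wB)
      (GBG + (GBG * κg + GBI * κI + GBB * κb) / (1 - qN) * wG) (GBI + (GBG * κg + GBI * κI + GBB * κb) / (1 - qN) * wI)
      (GBB + (GBG * κg + GBI * κI + GBB * κb) / (1 - qN) * wB) aHi Λ θ s := by
  intro δ hδ a ha S hS hsum hgood L w hLw x₀ K hKS hKq hmild hcool n xf hxf hrange y₀ hy₀ X' hperf hreg H hHd u Mg MI Mb hMg hMI hMb hload
  obtain ⟨A, hAd, hrespA⟩ := hl δ hδ a ha n X' y₀ hperf (isFatPatch_of_collarRegistered hsb.le hdI.le hdB.le hρB hKq hrange hy₀ hreg)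
  have hresp := hrespA (fun i => ∃ p ∈ S \ coreOf S K ρ, dist (y₀ i) p ≤ Rg) hreg.1 hreg.2.1
  have hdrift := hp δ hδ a ha S hS hsum hgood L w hLw x₀ K hKS hKq hmild hcool n xf hxf hrange y₀ hy₀ X' hperf hreg H hHd A hAd u
  have hwG : 0 ≤ wG := nonneg_of_mul_nonneg_left (h_sG.trans hwsG) hsb
  have hwI : 0 ≤ wI := nonneg_of_mul_nonneg_left (h_sI.trans hwsI) hsb
  have hwB : 0 ≤ wB := nonneg_of_mul_nonneg_left (h_sB.trans hwsB) hsb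
  have hclaim : ∀ lam : ℝ, 0 ≤ lam → y₀ + u ∈ bondTube (S \ coreOf S K ρ) Rg (lam * sb) (lam * dI) (lam * dB) y₀ →
      y₀ + u ∈ bondTube (S \ coreOf S K ρ) Rg (GsG * Mg + GsI * MI + GsB * Mb + lam * (GsG * κg + GsI * κI + GsB * κb))
        (GIG * Mg + GII * MI + GIB * Mb + lam * (GIG * κg + GII * κI + GIB * κb))
        (GBG * Mg + GBI * MI + GBB * Mb + lam * (GBG * κg + GBI * κI + GBB * κb)) y₀ := by
    intro lam hl0 hP
    have hd := hdrift lam hl0 hP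
    have hsum' := hload.add (hd.smul (c := (-1 : ℝ)) (by rw [abs_neg, abs_one]))
    have e : H u + (-1 : ℝ) • (H u - A u) = A u := by
      ext v; simp only [add_apply, sub_apply, smul_apply, smul_eq_mul]; ring
    rw [e] at hsum'
    have hY := hresp u (Mg + lam * κg) (MI + lam * κI) (Mb + lam * κb) (by positivity) (by positivity) (by positivity)
      (hasTubeFluxLoad_iff_hasTubeFluxLoadC.1 hsum')
    rw [← bondTube_eq_bondTubeC] at hY
    exact bondTube_mono (le_of_eq (by ring)) (le_of_eq (by ring)) (le_of_eq (by ring)) hY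
  obtain ⟨t, -, ht⟩ := exists_gauge_mem_bondTube (X := S \ coreOf S K ρ) (Rg := Rg) (y₀ := y₀) hsb hdI hdB u
  have hcore := bondTube_linear_bootstrap (m := wG * Mg + wI * MI + wB * Mb) hsb hdI hdB hq0 hq1 (by positivity)
    (by nlinarith [mul_le_mul_of_nonneg_right hwsG hMg, mul_le_mul_of_nonneg_right hwsI hMI, mul_le_mul_of_nonneg_right hwsB hMb])
    (by nlinarith [mul_le_mul_of_nonneg_right hwIG hMg, mul_le_mul_of_nonneg_right hwII hMI, mul_le_mul_of_nonneg_right hwIB hMb])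
    (by nlinarith [mul_le_mul_of_nonneg_right hwBG hMg, mul_le_mul_of_nonneg_right hwBI hMI, mul_le_mul_of_nonneg_right hwBB hMb])
    hcs hcI hcB ht hclaim
  exact bondTube_mono (le_of_eq (by ring)) (le_of_eq (by ring)) (le_of_eq (by ring)) hcore

/-- ★ **(XR♯) ⇒ (XR) (PROVED)**: a rigid collar-registered reference is in particular a tube reference — (XR♯) is the STRONGER existence piece. [this file, g72] -/
theorem tubeReferenceP_of_rigid {ϑc ϑ ϑp r q rsh ρ rm dm ϑ₀ Rg sb dI dB ε Rl Ru aHi Λ θ s : ℝ}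
    (hR : RigidReferenceP ϑc ϑ ϑp r q rsh ρ rm dm ϑ₀ Rg sb dI dB ε Rl Ru aHi Λ θ s) :
    TubeReferenceP ϑc ϑ ϑp r q rsh ρ rm dm ϑ₀ Rg sb dI dB aHi Λ θ s := by
  intro δ hδ a ha S hS hsum hgood L w hLw x₀ K hKS hKq hmild hcool n xf hxf hrange
  obtain ⟨y₀, X', hy₀, -, -⟩ := hR δ hδ a ha S hS hsum hgood L w hLw x₀ K hKS hKq hmild hcool n xf hxf hrange
  exact ⟨y₀, hy₀⟩

/-- ★ **(Gh) ⇒ (Gh♯) (PROVED)**: the restricted target is WEAKER than part YS's (Gh) (the extra binders are discarded). [this file, g72] -/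
theorem HarmonicResponseP.rigid {ϑc ϑ ϑp r q rsh ρ rm dm ϑ₀ Rg sb dI dB Rφ ε Rl Ru HsG HsI HsB HIG HII HIB HBG HBI HBB aHi Λ θ s : ℝ}
    (hH : HarmonicResponseP ϑc ϑ ϑp r q rsh ρ rm dm ϑ₀ Rg sb dI dB Rφ HsG HsI HsB HIG HII HIB HBG HBI HBB aHi Λ θ s) :
    RigidHarmonicResponseP ϑc ϑ ϑp r q rsh ρ rm dm ϑ₀ Rg sb dI dB Rφ ε Rl Ru HsG HsI HsB HIG HII HIB HBG HBI HBB aHi Λ θ s :=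
  fun δ hδ a ha S hS hsum hgood L w hLw x₀ K hKS hKq hmild hcool n xf hxf hrange y₀ hy₀ _ _ _ H hHd u Mg MI Mb hMg hMI hMb hload =>
    hH δ hδ a ha S hS hsum hgood L w hLw x₀ K hKS hKq hmild hcool n xf hxf hrange y₀ hy₀ H hHd u Mg MI Mb hMg hMI hMb hload

/-- **DIAL (PROVED): (Gh♯) is WEAKER for an entrywise larger matrix** (levels are nonnegative under its binders). [this file, g72] -/
theorem RigidHarmonicResponseP.of_le {ϑc ϑ ϑp r q rsh ρ rm dm ϑ₀ Rg sb dI dB Rφ ε Rl Ru HsG HsI HsB HIG HII HIB HBG HBI HBB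
    HsG' HsI' HsB' HIG' HII' HIB' HBG' HBI' HBB' aHi Λ θ s : ℝ}
    (hsG : HsG ≤ HsG') (hsI : HsI ≤ HsI') (hsB : HsB ≤ HsB') (hIG : HIG ≤ HIG') (hII : HII ≤ HII') (hIB : HIB ≤ HIB') (hBG : HBG ≤ HBG')
    (hBI : HBI ≤ HBI') (hBB : HBB ≤ HBB')
    (hH : RigidHarmonicResponseP ϑc ϑ ϑp r q rsh ρ rm dm ϑ₀ Rg sb dI dB Rφ ε Rl Ru HsG HsI HsB HIG HII HIB HBG HBI HBB aHi Λ θ s) :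
    RigidHarmonicResponseP ϑc ϑ ϑp r q rsh ρ rm dm ϑ₀ Rg sb dI dB Rφ ε Rl Ru HsG' HsI' HsB' HIG' HII' HIB' HBG' HBI' HBB' aHi Λ θ s :=
  fun δ hδ a ha S hS hsum hgood L w hLw x₀ K hKS hKq hmild hcool n xf hxf hrange y₀ hy₀ X' hX' hreg H hHd u Mg MI Mb hMg hMI hMb hload =>
    bondTube_mono (by nlinarith [mul_le_mul_of_nonneg_right hsG hMg, mul_le_mul_of_nonneg_right hsI hMI, mul_le_mul_of_nonneg_right hsB hMb])
      (by nlinarith [mul_le_mul_of_nonneg_right hIG hMg, mul_le_mul_of_nonneg_right hII hMI, mul_le_mul_of_nonneg_right hIB hMb])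
      (by nlinarith [mul_le_mul_of_nonneg_right hBG hMg, mul_le_mul_of_nonneg_right hBI hMI, mul_le_mul_of_nonneg_right hBB hMb])
      (hH δ hδ a ha S hS hsum hgood L w hLw x₀ K hKS hKq hmild hcool n xf hxf hrange y₀ hy₀ X' hX' hreg H hHd u Mg MI Mb hMg hMI hMb hload)

/-- **DIAL (PROVED): (Gp♯) is WEAKER for larger defect levels and a tighter registration** (`κ ≤ κ′`, `ε′ ≤ ε`, narrower band). [this file, g72] -/
theorem CollarPinDriftP.of_le {ϑc ϑ ϑp r q rsh ρ rm dm ϑ₀ Rg sb dI dB Rφ ε ε' Rl Rl' Ru Ru' κg κI κb κg' κI' κb' aHi Λ θ s : ℝ}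
    (hg : κg ≤ κg') (hI : κI ≤ κI') (hB : κb ≤ κb') (hε : ε' ≤ ε) (hl : Rl ≤ Rl') (hu : Ru' ≤ Ru)
    (hD : CollarPinDriftP ϑc ϑ ϑp r q rsh ρ rm dm ϑ₀ Rg sb dI dB Rφ ε Rl Ru κg κI κb aHi Λ θ s) :
    CollarPinDriftP ϑc ϑ ϑp r q rsh ρ rm dm ϑ₀ Rg sb dI dB Rφ ε' Rl' Ru' κg' κI' κb' aHi Λ θ s :=
  fun δ hδ a ha S hS hsum hgood L w hLw x₀ K hKS hKq hmild hcool n xf hxf hrange y₀ hy₀ X' hX' hreg H hHd A hAd u l hl0 hP =>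
    (hD δ hδ a ha S hS hsum hgood L w hLw x₀ K hKS hKq hmild hcool n xf hxf hrange y₀ hy₀ X' hX' (hreg.mono hε hl hu) H hHd A hAd u l hl0 hP).mono
      (mul_le_mul_of_nonneg_left hg hl0) (mul_le_mul_of_nonneg_left hI hl0) (mul_le_mul_of_nonneg_left hB hl0)

end NodeJunction

/-! ### YW-1  The restricted response and a-priori pieces (G∞♯) / (X2ᴸ♯) (typed; binders of (G∞)/(X2ᴸ) verbatim plus the rigid registration) -/

section Pieces

/-- ★★ **(G∞♯) «RigidTubeResponseP … Rg sb dI dB Rφ ε Rl Ru CsG … CBB …» — (G∞) RESTRICTED TO RIGID COLLAR-REGISTERED REFERENCES.**  Part YQ v2's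
`TubeResponseP` (class-split max-norm response across the tube: a tube member `z` with `D E(z) − D E(y₀)` of class levels `M ≥ 0` lies in `T(C·M)`) with
the reference additionally a placed perfect clamped patch `(X′, y₀)` collar-registered to the exterior.  WEAKER than (G∞) (PROVED `TubeResponseP.rigid`);
cut by (Gh♯) ∧ (Gs) (PROVED `rigidTubeResponseP_of_tangent`). [this file, g72] -/
def RigidTubeResponseP (ϑc ϑ ϑp r q rsh ρ rm dm ϑ₀ Rg sb dI dB Rφ ε Rl Ru CsG CsI CsB CIG CII CIB CBG CBI CBB aHi Λ θ s : ℝ) : Prop :=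
  ∀ δ : ℝ, 0 < δ → ∀ a : ℝ, 0 < a →
    ∀ S : Set E3, IsDoorSetP aHi δ S → (∀ z : E3, Summable fun y : S => lennardJones (dist z (y : E3))) →
      (∀ p ∈ S, IsTwoShellAffineGood θ S p) →
        ∀ (L : E3 ≃L[ℝ] E3) (w : ℤ → E3), IsEquilChart a s Λ L w →
          ∀ (x₀ : E3) (K : Set E3), K ⊆ S → (∀ k ∈ K, dist k x₀ ≤ q) →
            IsTameOn ϑp S (LayeredHom (L : E3 →L[ℝ] E3) w) (coreOf S K rm) →
              IsTameOn ϑc S (LayeredHom (L : E3 →L[ℝ] E3) w) (moatIn S K r (r + rsh)) →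
                ∀ (n : ℕ) (xf : Fin n → E3), Function.Injective xf → Set.range xf = coreOf S K ρ →
                  ∀ y₀ : Fin n → E3, IsTubeReference ϑ₀ ϑ dm Rg sb dI dB (S \ coreOf S K ρ) (LayeredHom (L : E3 →L[ℝ] E3) w) xf y₀ →
                    ∀ X' : Set E3, IsPlacedPerfectPatch aHi δ θ a s Λ X' y₀ →
                      IsCollarRegistered ε Rl Rg Ru {z | ∃ k ∈ K, dist z k < r + rsh} (S \ coreOf S K ρ) X' y₀ →
                        ∀ φ₀ : (Fin n → E3) →L[ℝ] ℝ, HasFDerivAt (fun z : Fin n → E3 => clampedEnergy (S \ coreOf S K ρ) z) φ₀ y₀ →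
                          ∀ z ∈ bondTube (S \ coreOf S K ρ) Rg sb dI dB y₀, ∀ φ : (Fin n → E3) →L[ℝ] ℝ,
                            HasFDerivAt (fun z : Fin n → E3 => clampedEnergy (S \ coreOf S K ρ) z) φ z →
                              ∀ Mg MI Mb : ℝ, 0 ≤ Mg → 0 ≤ MI → 0 ≤ Mb →
                                HasTubeFluxLoad (S \ coreOf S K ρ) Rg Rφ Mg MI Mb y₀ (φ - φ₀) →
                                  z ∈ bondTube (S \ coreOf S K ρ) Rg (CsG * Mg + CsI * MI + CsB * Mb) (CIG * Mg + CII * MI + CIB * Mb)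
                                    (CBG * Mg + CBI * MI + CBB * Mb) y₀

/-- ★★ **(X2ᴸ♯) «RigidLoadedTubeAprioriP … Rg sb dI dB ε Rl Ru sb₁ dI₁ dB₁ …» — (X2ᴸ) RESTRICTED TO RIGID COLLAR-REGISTERED REFERENCES.**  Part YO's
`LoadedTubeAprioriP` (every critical point in the outer tube of the clamped energy loaded by `(1 − t)·φ₀`, `t ∈ [0, 1]`, lies in the inner tube
`T(sb₁, dI₁, dB₁)`) with the reference additionally a placed perfect clamped patch collar-registered to the exterior.  WEAKER than (X2ᴸ) (PROVED
`LoadedTubeAprioriP.rigid`); cut by (G∞♯) ∧ (Res) (PROVED `rigidLoadedTubeAprioriP_of_response`). [this file, g72] -/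
def RigidLoadedTubeAprioriP (ϑc ϑ ϑp r q rsh ρ rm dm ϑ₀ Rg sb dI dB ε Rl Ru sb₁ dI₁ dB₁ aHi Λ θ s : ℝ) : Prop :=
  ∀ δ : ℝ, 0 < δ → ∀ a : ℝ, 0 < a →
    ∀ S : Set E3, IsDoorSetP aHi δ S → (∀ z : E3, Summable fun y : S => lennardJones (dist z (y : E3))) →
      (∀ p ∈ S, IsTwoShellAffineGood θ S p) →
        ∀ (L : E3 ≃L[ℝ] E3) (w : ℤ → E3), IsEquilChart a s Λ L w →
          ∀ (x₀ : E3) (K : Set E3), K ⊆ S → (∀ k ∈ K, dist k x₀ ≤ q) →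
            IsTameOn ϑp S (LayeredHom (L : E3 →L[ℝ] E3) w) (coreOf S K rm) →
              IsTameOn ϑc S (LayeredHom (L : E3 →L[ℝ] E3) w) (moatIn S K r (r + rsh)) →
                ∀ (n : ℕ) (xf : Fin n → E3), Function.Injective xf → Set.range xf = coreOf S K ρ →
                  ∀ y₀ : Fin n → E3, IsTubeReference ϑ₀ ϑ dm Rg sb dI dB (S \ coreOf S K ρ) (LayeredHom (L : E3 →L[ℝ] E3) w) xf y₀ →
                    ∀ X' : Set E3, IsPlacedPerfectPatch aHi δ θ a s Λ X' y₀ →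
                      IsCollarRegistered ε Rl Rg Ru {z | ∃ k ∈ K, dist z k < r + rsh} (S \ coreOf S K ρ) X' y₀ →
                        ∀ φ₀ : (Fin n → E3) →L[ℝ] ℝ, HasFDerivAt (fun z : Fin n → E3 => clampedEnergy (S \ coreOf S K ρ) z) φ₀ y₀ →
                          ∀ t : ℝ, 0 ≤ t → t ≤ 1 → ∀ z ∈ bondTube (S \ coreOf S K ρ) Rg sb dI dB y₀,
                            HasFDerivAt (fun z : Fin n → E3 => clampedEnergy (S \ coreOf S K ρ) z) ((1 - t) • φ₀) z →
                              z ∈ bondTube (S \ coreOf S K ρ) Rg sb₁ dI₁ dB₁ y₀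

/-- **(G∞) ⇒ (G∞♯) (PROVED)** — the restriction is WEAKER. [this file, g72] -/
theorem TubeResponseP.rigid {ϑc ϑ ϑp r q rsh ρ rm dm ϑ₀ Rg sb dI dB Rφ ε Rl Ru CsG CsI CsB CIG CII CIB CBG CBI CBB aHi Λ θ s : ℝ}
    (hG : TubeResponseP ϑc ϑ ϑp r q rsh ρ rm dm ϑ₀ Rg sb dI dB Rφ CsG CsI CsB CIG CII CIB CBG CBI CBB aHi Λ θ s) :
    RigidTubeResponseP ϑc ϑ ϑp r q rsh ρ rm dm ϑ₀ Rg sb dI dB Rφ ε Rl Ru CsG CsI CsB CIG CII CIB CBG CBI CBB aHi Λ θ s :=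
  fun δ hδ a ha S hS hsum hgood L w hLw x₀ K hKS hKq hmild hcool n xf hxf hrange y₀ hy₀ _ _ _ =>
    hG δ hδ a ha S hS hsum hgood L w hLw x₀ K hKS hKq hmild hcool n xf hxf hrange y₀ hy₀

/-- **(X2ᴸ) ⇒ (X2ᴸ♯) (PROVED)** — the restriction is WEAKER. [this file, g72] -/
theorem LoadedTubeAprioriP.rigid {ϑc ϑ ϑp r q rsh ρ rm dm ϑ₀ Rg sb dI dB ε Rl Ru sb₁ dI₁ dB₁ aHi Λ θ s : ℝ}
    (hA : LoadedTubeAprioriP ϑc ϑ ϑp r q rsh ρ rm dm ϑ₀ Rg sb dI dB sb₁ dI₁ dB₁ aHi Λ θ s) :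
    RigidLoadedTubeAprioriP ϑc ϑ ϑp r q rsh ρ rm dm ϑ₀ Rg sb dI dB ε Rl Ru sb₁ dI₁ dB₁ aHi Λ θ s :=
  fun δ hδ a ha S hS hsum hgood L w hLw x₀ K hKS hKq hmild hcool n xf hxf hrange y₀ hy₀ _ _ _ =>
    hA δ hδ a ha S hS hsum hgood L w hLw x₀ K hKS hKq hmild hcool n xf hxf hrange y₀ hy₀

end Pieces

/-! ### YW-2  THE JUNCTIONS (PROVED): (G∞♯) ⟸ (Gh♯) ∧ (Gs); (X2ᴸ♯) ⟸ (G∞♯) ∧ (Res); (QE) ⟸ (XR♯) ∧ (X1) ∧ (X2ᴸ♯); the slot; the whole line -/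

section Junctions

/-- ★★★ **(G∞♯) ⟸ (Gh♯)(H) ∧ (Gs)(κ) ∧ Neumann arithmetic (PROVED)** — part YS's `tubeResponseP_of_tangent` for the restricted class: (Gs) is instantiated
at the rigid reference (it holds for all references), (Gh♯) at the registration in hand; `C_{k,c} = H_{k,c} + (Hκ)_k·w_c/(1 − qN)`. [this file, g72] -/
theorem rigidTubeResponseP_of_tangent
    {ϑc ϑ ϑp r q rsh ρ rm dm ϑ₀ Rg sb dI dB Rφ ε Rl Ru HsG HsI HsB HIG HII HIB HBG HBI HBB κg κI κb qN wG wI wB aHi Λ θ s : ℝ}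
    (hsb : 0 < sb) (hdI : 0 < dI) (hdB : 0 < dB) (hq0 : 0 ≤ qN) (hq1 : qN < 1)
    (h_sG : 0 ≤ HsG) (h_sI : 0 ≤ HsI) (h_sB : 0 ≤ HsB) (h_IG : 0 ≤ HIG) (h_II : 0 ≤ HII) (h_IB : 0 ≤ HIB)
    (h_BG : 0 ≤ HBG) (h_BI : 0 ≤ HBI) (h_BB : 0 ≤ HBB) (hκg : 0 ≤ κg) (hκI : 0 ≤ κI) (hκb : 0 ≤ κb)
    (hwsG : HsG ≤ wG * sb) (hwIG : HIG ≤ wG * dI) (hwBG : HBG ≤ wG * dB) (hwsI : HsI ≤ wI * sb) (hwII : HII ≤ wI * dI) (hwBI : HBI ≤ wI * dB)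
    (hwsB : HsB ≤ wB * sb) (hwIB : HIB ≤ wB * dI) (hwBB : HBB ≤ wB * dB)
    (hcs : HsG * κg + HsI * κI + HsB * κb ≤ qN * sb) (hcI : HIG * κg + HII * κI + HIB * κb ≤ qN * dI)
    (hcB : HBG * κg + HBI * κI + HBB * κb ≤ qN * dB)
    (hH : RigidHarmonicResponseP ϑc ϑ ϑp r q rsh ρ rm dm ϑ₀ Rg sb dI dB Rφ ε Rl Ru HsG HsI HsB HIG HII HIB HBG HBI HBB aHi Λ θ s)
    (hD : TangentDriftP ϑc ϑ ϑp r q rsh ρ rm dm ϑ₀ Rg sb dI dB Rφ κg κI κb aHi Λ θ s) :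
    RigidTubeResponseP ϑc ϑ ϑp r q rsh ρ rm dm ϑ₀ Rg sb dI dB Rφ ε Rl Ru
      (HsG + (HsG * κg + HsI * κI + HsB * κb) / (1 - qN) * wG) (HsI + (HsG * κg + HsI * κI + HsB * κb) / (1 - qN) * wI)
      (HsB + (HsG * κg + HsI * κI + HsB * κb) / (1 - qN) * wB)
      (HIG + (HIG * κg + HII * κI + HIB * κb) / (1 - qN) * wG) (HII + (HIG * κg + HII * κI + HIB * κb) / (1 - qN) * wI)
      (HIB + (HIG * κg + HII * κI + HIB * κb) / (1 - qN) * wB)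
      (HBG + (HBG * κg + HBI * κI + HBB * κb) / (1 - qN) * wG) (HBI + (HBG * κg + HBI * κI + HBB * κb) / (1 - qN) * wI)
      (HBB + (HBG * κg + HBI * κI + HBB * κb) / (1 - qN) * wB) aHi Λ θ s := by
  intro δ hδ a ha S hS hsum hgood L w hLw x₀ K hKS hKq hmild hcool n xf hxf hrange y₀ hy₀ X' hX' hreg φ₀ hφ₀ z hz φ hφ Mg MI Mb hMg hMI hMb hload
  obtain ⟨H, hHd, hdrift⟩ := hD δ hδ a ha S hS hsum hgood L w hLw x₀ K hKS hKq hmild hcool n xf hxf hrange y₀ hy₀ φ₀ hφ₀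
  have hresp := hH δ hδ a ha S hS hsum hgood L w hLw x₀ K hKS hKq hmild hcool n xf hxf hrange y₀ hy₀ X' hX' hreg H hHd
  have hwG : 0 ≤ wG := nonneg_of_mul_nonneg_left (h_sG.trans hwsG) hsb
  have hwI : 0 ≤ wI := nonneg_of_mul_nonneg_left (h_sI.trans hwsI) hsb
  have hwB : 0 ≤ wB := nonneg_of_mul_nonneg_left (h_sB.trans hwsB) hsb
  have hclaim : ∀ lam : ℝ, 0 ≤ lam → lam ≤ 1 → z ∈ bondTube (S \ coreOf S K ρ) Rg (lam * sb) (lam * dI) (lam * dB) y₀ →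
      z ∈ bondTube (S \ coreOf S K ρ) Rg (HsG * Mg + HsI * MI + HsB * Mb + lam * (HsG * κg + HsI * κI + HsB * κb))
        (HIG * Mg + HII * MI + HIB * Mb + lam * (HIG * κg + HII * κI + HIB * κb))
        (HBG * Mg + HBI * MI + HBB * Mb + lam * (HBG * κg + HBI * κI + HBB * κb)) y₀ := by
    intro lam hl0 hl1 hP
    have hd := hdrift z hz φ hφ lam hl0 hl1 hP
    have hsum' := hload.add (hd.smul (c := (-1 : ℝ)) (by rw [abs_neg, abs_one]))
    have e : (φ - φ₀) + (-1 : ℝ) • (φ - φ₀ - H (z - y₀)) = H (z - y₀) := by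
      ext v; simp only [add_apply, sub_apply, smul_apply, smul_eq_mul]; ring
    rw [e] at hsum'
    have hz' := hresp (z - y₀) (Mg + lam * κg) (MI + lam * κI) (Mb + lam * κb) (by positivity) (by positivity) (by positivity) hsum'
    have e' : y₀ + (z - y₀) = z := by abel
    rw [e'] at hz'
    exact bondTube_mono (le_of_eq (by ring)) (le_of_eq (by ring)) (le_of_eq (by ring)) hz'
  have hcore := bondTube_bootstrap (m := wG * Mg + wI * MI + wB * Mb) hsb hdI hdB hq0 hq1 (by positivity) (by positivity) (by positivity)
    (by positivity) (by nlinarith [mul_le_mul_of_nonneg_right hwsG hMg, mul_le_mul_of_nonneg_right hwsI hMI, mul_le_mul_of_nonneg_right hwsB hMb])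
    (by nlinarith [mul_le_mul_of_nonneg_right hwIG hMg, mul_le_mul_of_nonneg_right hwII hMI, mul_le_mul_of_nonneg_right hwIB hMb])
    (by nlinarith [mul_le_mul_of_nonneg_right hwBG hMg, mul_le_mul_of_nonneg_right hwBI hMI, mul_le_mul_of_nonneg_right hwBB hMb])
    hcs hcI hcB hz hclaim
  exact bondTube_mono (le_of_eq (by ring)) (le_of_eq (by ring)) (le_of_eq (by ring)) hcore

/-- ★★★ **(X2ᴸ♯) ⟸ (G∞♯)(C) ∧ (Res)(ε ≥ 0) ∧ `C·ε ≤ ρ₁` (PROVED)** — part YQ v2's `loadedTubeAprioriP_of_response` for the restricted class: a loaded tube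
solution `z` has `D E(z) − φ₀ = −t·φ₀` of class levels `(εg, εI, εb)` ((Res), instantiated at the rigid reference; `|−t| ≤ 1`), and (G∞♯) places `z` in
the response tube, inside the inner tube by the arithmetic. [this file, g72] -/
theorem rigidLoadedTubeAprioriP_of_response
    {ϑc ϑ ϑp r q rsh ρ rm dm ϑ₀ Rg sb dI dB Rφ ε Rl Ru CsG CsI CsB CIG CII CIB CBG CBI CBB εg εI εb sb₁ dI₁ dB₁ aHi Λ θ s : ℝ}
    (hεg : 0 ≤ εg) (hεI : 0 ≤ εI) (hεb : 0 ≤ εb)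
    (hs : CsG * εg + CsI * εI + CsB * εb ≤ sb₁) (hI : CIG * εg + CII * εI + CIB * εb ≤ dI₁) (hB : CBG * εg + CBI * εI + CBB * εb ≤ dB₁)
    (hG : RigidTubeResponseP ϑc ϑ ϑp r q rsh ρ rm dm ϑ₀ Rg sb dI dB Rφ ε Rl Ru CsG CsI CsB CIG CII CIB CBG CBI CBB aHi Λ θ s)
    (hL : ReferenceLoadP ϑc ϑ ϑp r q rsh ρ rm dm ϑ₀ Rg sb dI dB Rφ εg εI εb aHi Λ θ s) :
    RigidLoadedTubeAprioriP ϑc ϑ ϑp r q rsh ρ rm dm ϑ₀ Rg sb dI dB ε Rl Ru sb₁ dI₁ dB₁ aHi Λ θ s := by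
  intro δ hδ a ha S hS hsum hgood L w hLw x₀ K hKS hKq hmild hcool n xf hxf hrange y₀ hy₀ X' hX' hreg φ₀ hφ₀ t ht0 ht1 z hz hcrit
  have hload : HasTubeFluxLoad (S \ coreOf S K ρ) Rg Rφ εg εI εb y₀ ((1 - t) • φ₀ - φ₀) := by
    have e : (1 - t) • φ₀ - φ₀ = (-t) • φ₀ := by
      ext v; simp only [sub_apply, smul_apply, smul_eq_mul]; ring
    rw [e]
    exact (hL δ hδ a ha S hS hsum hgood L w hLw x₀ K hKS hKq hmild hcool n xf hxf hrange y₀ hy₀ φ₀ hφ₀).smul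
      (by rw [abs_neg, abs_of_nonneg ht0]; exact ht1)
  exact bondTube_mono hs hI hB
    (hG δ hδ a ha S hS hsum hgood L w hLw x₀ K hKS hKq hmild hcool n xf hxf hrange y₀ hy₀ X' hX' hreg φ₀ hφ₀ z hz _ hcrit εg εI εb hεg hεI hεb hload)

/-- ★★★ **THE RIGID LOAD-PATH GLUE (PROVED): (XR♯) ∧ (X1)(lam > 0) ∧ (X2ᴸ♯)(0 ≤ sb₁ < sb, 0 ≤ dI₁ < dI, 0 ≤ dB₁ < dB) ⇒ (QE)(ϑc, ϑ, ϑp, dm)** — part YO's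
`coolMoatSlavedFillingP_of_loadPath` with the reference taken from (XR♯) (a rigid collar-registered reference, in particular a tube reference) and the
a-priori confinement (X2ᴸ♯) used at that reference's registration; (X1) is instantiated at the reference (it holds for all tube references); the engine
`exists_hasFDerivAt_zero_of_loadPath` and the certification of the limit by `IsTubeReference` exactly as in part YO. [this file, g72] -/
theorem coolMoatSlavedFillingP_of_rigidLoadPath {ϑc ϑ ϑp r q rsh ρ rm dm ϑ₀ Rg sb dI dB ε Rl Ru sb₁ dI₁ dB₁ lam aHi Λ θ s : ℝ}
    (hlam : 0 < lam) (hsb : sb₁ < sb) (hdI : dI₁ < dI) (hdB : dB₁ < dB) (hsb₀ : 0 ≤ sb₁) (hdI₀ : 0 ≤ dI₁) (hdB₀ : 0 ≤ dB₁)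
    (hR : RigidReferenceP ϑc ϑ ϑp r q rsh ρ rm dm ϑ₀ Rg sb dI dB ε Rl Ru aHi Λ θ s)
    (hC : TubeConvexityP ϑc ϑ ϑp r q rsh ρ rm dm ϑ₀ Rg sb dI dB lam aHi Λ θ s)
    (hA : RigidLoadedTubeAprioriP ϑc ϑ ϑp r q rsh ρ rm dm ϑ₀ Rg sb dI dB ε Rl Ru sb₁ dI₁ dB₁ aHi Λ θ s) :
    CoolMoatSlavedFillingP ϑc ϑ ϑp r q rsh ρ rm dm aHi Λ θ s := by
  intro δ hδ a ha S hS hsum hgood L w hLw x₀ K hKS hKq hmild hcool n xf hxf hrange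
  obtain ⟨y₀, X', hy₀, hX', hreg⟩ := hR δ hδ a ha S hS hsum hgood L w hLw x₀ K hKS hKq hmild hcool n xf hxf hrange
  have hSC := hC δ hδ a ha S hS hsum hgood L w hLw x₀ K hKS hKq hmild hcool n xf hxf hrange y₀ hy₀
  have hT₁T : bondTube (S \ coreOf S K ρ) Rg sb₁ dI₁ dB₁ y₀ ⊆ bondTube (S \ coreOf S K ρ) Rg sb dI dB y₀ :=
    bondTube_mono hsb.le hdI.le hdB.le
  have hy₀T₁ : y₀ ∈ bondTube (S \ coreOf S K ρ) Rg sb₁ dI₁ dB₁ y₀ := self_mem_bondTube hsb₀ hdI₀ hdB₀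
  obtain ⟨φ₀, hφ₀, -⟩ := hSC y₀ (hT₁T hy₀T₁)
  have hAp := hA δ hδ a ha S hS hsum hgood L w hLw x₀ K hKS hKq hmild hcool n xf hxf hrange y₀ hy₀ X' hX' hreg φ₀ hφ₀
  have hgap : 0 < min ((sb - sb₁) / 4) (min ((dI - dI₁) / 2) ((dB - dB₁) / 2)) :=
    lt_min (by linarith) (lt_min (by linarith) (by linarith))
  have hg1 : min ((sb - sb₁) / 4) (min ((dI - dI₁) / 2) ((dB - dB₁) / 2)) ≤ (sb - sb₁) / 4 := min_le_left _ _
  have hg2 : min ((sb - sb₁) / 4) (min ((dI - dI₁) / 2) ((dB - dB₁) / 2)) ≤ (dI - dI₁) / 2 := (min_le_right _ _).trans (min_le_left _ _)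
  have hg3 : min ((sb - sb₁) / 4) (min ((dI - dI₁) / 2) ((dB - dB₁) / 2)) ≤ (dB - dB₁) / 2 := (min_le_right _ _).trans (min_le_right _ _)
  obtain ⟨z, hz₁, hz⟩ := exists_hasFDerivAt_zero_of_loadPath
    (E := fun z : Fin n → E3 => clampedEnergy (S \ coreOf S K ρ) z) (D := fun z z' : Fin n → E3 => ∑ i, dist (z i) (z' i) ^ 2)
    (isCompact_bondTube (hdB₀.trans hdB.le)) convex_bondTube hT₁T hy₀T₁ hgap
    (fun z hz z' hz' => bondTube_margin (by linarith) (by linarith) (by linarith) hz hz') hlam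
    (fun z z' => norm_sub_sq_le_sum_dist_sq z z') hφ₀ hSC hAp
  obtain ⟨hinj, hdisj, hnear, htame⟩ := hy₀.2 z (hT₁T hz₁)
  exact ⟨z, hinj, hdisj, hnear, hz, htame⟩

/-- ★★ **THE RIGID TUBE-DOCKET SLOT (PROVED)**: at the docket geometry `(r, q, rsh, ρ, rm) = (8, 4, 12, 16, 16)`, `(aHi, Λ, θ, s) = (1, 2, 1/16, 1/50)`,
`dm = 1/2`, the three pieces (XR♯) ∧ (X1) ∧ (X2ᴸ♯) give EXACTLY the existence leaf `CoolMoatSlavedFillingP ϑm ϑf ϑp 8 4 12 16 16 (1/2) 1 2 (1/16) (1/50)` of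
`MildTubeDocket` / `VariationalMildDocket` (column `_16XH28BVT`, `∃ ϑm`) — tube radii, reference tameness `ϑ₀`, registration `(ε, Rl, Ru)` and
modulus `lam` FREE. [this file, g72] -/
theorem coolMoatSlavedFillingP_tubeSlot_of_rigidLoadPath {ϑm ϑf ϑp ϑ₀ Rg sb dI dB ε Rl Ru sb₁ dI₁ dB₁ lam : ℝ}
    (hlam : 0 < lam) (hsb : sb₁ < sb) (hdI : dI₁ < dI) (hdB : dB₁ < dB) (hsb₀ : 0 ≤ sb₁) (hdI₀ : 0 ≤ dI₁) (hdB₀ : 0 ≤ dB₁)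
    (hR : RigidReferenceP ϑm ϑf ϑp 8 4 12 16 16 (1 / 2) ϑ₀ Rg sb dI dB ε Rl Ru 1 2 (1 / 16) (1 / 50))
    (hC : TubeConvexityP ϑm ϑf ϑp 8 4 12 16 16 (1 / 2) ϑ₀ Rg sb dI dB lam 1 2 (1 / 16) (1 / 50))
    (hA : RigidLoadedTubeAprioriP ϑm ϑf ϑp 8 4 12 16 16 (1 / 2) ϑ₀ Rg sb dI dB ε Rl Ru sb₁ dI₁ dB₁ 1 2 (1 / 16) (1 / 50)) :
    CoolMoatSlavedFillingP ϑm ϑf ϑp 8 4 12 16 16 (1 / 2) 1 2 (1 / 16) (1 / 50) :=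
  coolMoatSlavedFillingP_of_rigidLoadPath hlam hsb hdI hdB hsb₀ hdI₀ hdB₀ hR hC hA

/-- ★★ **THE WHOLE RIGID LINE IN ONE THEOREM (PROVED)**: (XR♯) ∧ (X1) ∧ (Gh♯)(H) ∧ (Gs)(κ) ∧ (Res)(ε) with the two Neumann/level arithmetics ⇒ (QE) —
the three junctions of this part composed (the matrix of (G∞♯) is the Neumann matrix of `rigidTubeResponseP_of_tangent`).  With part YV's junction
`rigidHarmonicResponseP_of_placed` supplying (Gh♯) from (Gl♯) ∧ (Gp♯), and part YR's `referenceLoadP_of_nearFar` supplying (Res) from (Rn) ∧ (Rt), every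
leaf of the 26636 existence line is SPECIAL (one perfect patch: (X1), (Gl♯)), FORWARD ((Gp♯), (Gs)) or KINEMATIC ((XR♯), (Rn), (Rt)). [this file, g72] -/
theorem coolMoatSlavedFillingP_of_rigidTangentLine
    {ϑc ϑ ϑp r q rsh ρ rm dm ϑ₀ Rg sb dI dB Rφ ε Rl Ru HsG HsI HsB HIG HII HIB HBG HBI HBB κg κI κb qN wG wI wB εg εI εb sb₁ dI₁ dB₁ lam
      aHi Λ θ s : ℝ}
    (hsb : 0 < sb) (hdI : 0 < dI) (hdB : 0 < dB) (hq0 : 0 ≤ qN) (hq1 : qN < 1)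
    (h_sG : 0 ≤ HsG) (h_sI : 0 ≤ HsI) (h_sB : 0 ≤ HsB) (h_IG : 0 ≤ HIG) (h_II : 0 ≤ HII) (h_IB : 0 ≤ HIB)
    (h_BG : 0 ≤ HBG) (h_BI : 0 ≤ HBI) (h_BB : 0 ≤ HBB) (hκg : 0 ≤ κg) (hκI : 0 ≤ κI) (hκb : 0 ≤ κb)
    (hwsG : HsG ≤ wG * sb) (hwIG : HIG ≤ wG * dI) (hwBG : HBG ≤ wG * dB) (hwsI : HsI ≤ wI * sb) (hwII : HII ≤ wI * dI) (hwBI : HBI ≤ wI * dB)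
    (hwsB : HsB ≤ wB * sb) (hwIB : HIB ≤ wB * dI) (hwBB : HBB ≤ wB * dB)
    (hcs : HsG * κg + HsI * κI + HsB * κb ≤ qN * sb) (hcI : HIG * κg + HII * κI + HIB * κb ≤ qN * dI)
    (hcB : HBG * κg + HBI * κI + HBB * κb ≤ qN * dB)
    (hεg : 0 ≤ εg) (hεI : 0 ≤ εI) (hεb : 0 ≤ εb) (hsb₀ : 0 ≤ sb₁) (hdI₀ : 0 ≤ dI₁) (hdB₀ : 0 ≤ dB₁) (hsb₁ : sb₁ < sb) (hdI₁ : dI₁ < dI)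
    (hdB₁ : dB₁ < dB) (hlam : 0 < lam)
    (hs : (HsG + (HsG * κg + HsI * κI + HsB * κb) / (1 - qN) * wG) * εg + (HsI + (HsG * κg + HsI * κI + HsB * κb) / (1 - qN) * wI) * εI +
      (HsB + (HsG * κg + HsI * κI + HsB * κb) / (1 - qN) * wB) * εb ≤ sb₁)
    (hI : (HIG + (HIG * κg + HII * κI + HIB * κb) / (1 - qN) * wG) * εg + (HII + (HIG * κg + HII * κI + HIB * κb) / (1 - qN) * wI) * εI +
      (HIB + (HIG * κg + HII * κI + HIB * κb) / (1 - qN) * wB) * εb ≤ dI₁)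
    (hB : (HBG + (HBG * κg + HBI * κI + HBB * κb) / (1 - qN) * wG) * εg + (HBI + (HBG * κg + HBI * κI + HBB * κb) / (1 - qN) * wI) * εI +
      (HBB + (HBG * κg + HBI * κI + HBB * κb) / (1 - qN) * wB) * εb ≤ dB₁)
    (hR : RigidReferenceP ϑc ϑ ϑp r q rsh ρ rm dm ϑ₀ Rg sb dI dB ε Rl Ru aHi Λ θ s)
    (hC : TubeConvexityP ϑc ϑ ϑp r q rsh ρ rm dm ϑ₀ Rg sb dI dB lam aHi Λ θ s)
    (hH : RigidHarmonicResponseP ϑc ϑ ϑp r q rsh ρ rm dm ϑ₀ Rg sb dI dB Rφ ε Rl Ru HsG HsI HsB HIG HII HIB HBG HBI HBB aHi Λ θ s)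
    (hD : TangentDriftP ϑc ϑ ϑp r q rsh ρ rm dm ϑ₀ Rg sb dI dB Rφ κg κI κb aHi Λ θ s)
    (hL : ReferenceLoadP ϑc ϑ ϑp r q rsh ρ rm dm ϑ₀ Rg sb dI dB Rφ εg εI εb aHi Λ θ s) :
    CoolMoatSlavedFillingP ϑc ϑ ϑp r q rsh ρ rm dm aHi Λ θ s :=
  coolMoatSlavedFillingP_of_rigidLoadPath hlam hsb₁ hdI₁ hdB₁ hsb₀ hdI₀ hdB₀ hR hC
    (rigidLoadedTubeAprioriP_of_response hεg hεI hεb hs hI hB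
      (rigidTubeResponseP_of_tangent hsb hdI hdB hq0 hq1 h_sG h_sI h_sB h_IG h_II h_IB h_BG h_BI h_BB hκg hκI hκb hwsG hwIG hwBG hwsI hwII hwBI
        hwsB hwIB hwBB hcs hcI hcB hH hD) hL)

end Junctions

end Summit.AtomisticToContinuum.Crystallization.Theorems.ChartedZeroExcessLayeredLatticeLiouville

end
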